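import Literature.MathematicalPhysics.QuantumLattice.HubbardPairEnergyNondegenerate
import Mathlib.Topology.UniformSpace.HeineCantor
import HarnessLib

/-!
# Uniform second-order nondegeneracy of the pair energy on compact sub-bands

Topic `Literature/MathematicalPhysics/QuantumLattice`; continues `HubbardPairEnergyNondegenerate`
(pointwise: the pair energy `G = ε(p + γ_μ(θ) + γ_μ(φ)) - μ` and its slice derivatives
`∂_θG, ∂_φG, ∂²_θG, ∂²_φG, (∂_θ+∂_φ)²G` never vanish simultaneously) and `HubbardPairEnergy`
(joint continuity in `(μ, p, θ, φ)`, `2π`-periodicity in `p`).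

**Theorem** (`exists_uniform_nondegeneracy`). For a compact sub-band `[μ₁, μ₂] ⊂ (-4, 0)` there
are `c > 0` and a margin `0 < ℓ ≤ π` such that for every `μ ∈ [μ₁, μ₂]`, every `p ∈ ℝ²` and every
base point `(θ₀, φ₀) ∈ [-π, π]²`, ONE of the six quantities is `≥ c` in absolute value on the whole
`ℓ`-box `|θ - θ₀| ≤ ℓ`, `|φ - φ₀| ≤ ℓ` (compactness: the maximum of the six absolute values is a
positive continuous function, hence bounded below on a compact period box, and the six functions
are uniformly continuous there; `p` is reduced modulo `2π`).

Everything is proved; no definitions. [folklore]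
-/

noncomputable section

open Real Set Filter
open scoped Topology

namespace Literature.MathematicalPhysics.QuantumLattice

/-- The parameter space `(μ, p, θ, φ)` (local notation). -/
local notation "𝕐" => ℝ × (ℝ × ℝ) × ℝ × ℝ

/-- Reduction of `p` modulo `2π` into `(-π, π]²` does not change the six quantities. [folklore] -/
theorem pairE_all_reduce (μ : ℝ) (p : ℝ × ℝ) :
    ∃ q : ℝ × ℝ, q ∈ Icc (-π) π ×ˢ Icc (-π) π ∧ ∀ θ φ : ℝ,
      pairE μ q θ φ = pairE μ p θ φ ∧ pairE₁ μ q θ φ = pairE₁ μ p θ φ ∧ pairE₂ μ q θ φ = pairE₂ μ p θ φ ∧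
      pairE₁₁ μ q θ φ = pairE₁₁ μ p θ φ ∧ pairE₂₂ μ q θ φ = pairE₂₂ μ p θ φ ∧ pairEdd μ q θ φ = pairEdd μ p θ φ := by
  set m : ℤ := -toIocDiv Real.two_pi_pos (-π) p.1 with hm
  set n : ℤ := -toIocDiv Real.two_pi_pos (-π) p.2 with hn
  have h1 : toIocMod Real.two_pi_pos (-π) p.1 = p.1 + m * (2 * π) := by
    rw [hm, toIocMod, zsmul_eq_mul]; push_cast; ring
  have h2 : toIocMod Real.two_pi_pos (-π) p.2 = p.2 + n * (2 * π) := by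
    rw [hn, toIocMod, zsmul_eq_mul]; push_cast; ring
  have hm1 := toIocMod_mem_Ioc Real.two_pi_pos (-π) p.1
  have hm2 := toIocMod_mem_Ioc Real.two_pi_pos (-π) p.2
  refine ⟨(p.1 + m * (2 * π), p.2 + n * (2 * π)), ?_, fun θ φ => pairE_all_periodic μ p m n θ φ⟩
  rw [← h1, ← h2]
  exact ⟨⟨hm1.1.le, by linarith [hm1.2]⟩, ⟨hm2.1.le, by linarith [hm2.2]⟩⟩

/-- **Uniform second-order nondegeneracy with margins.** [folklore] -/
theorem exists_uniform_nondegeneracy {μ₁ μ₂ : ℝ} (h₁ : -4 < μ₁) (h₂ : μ₂ < 0) :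
    ∃ c ℓ : ℝ, 0 < c ∧ 0 < ℓ ∧ ℓ ≤ π ∧ ∀ μ ∈ Icc μ₁ μ₂, ∀ p : ℝ × ℝ, ∀ θ₀ ∈ Icc (-π) π, ∀ φ₀ ∈ Icc (-π) π,
      (∀ θ φ, |θ - θ₀| ≤ ℓ → |φ - φ₀| ≤ ℓ → c ≤ |pairE μ p θ φ|) ∨
      (∀ θ φ, |θ - θ₀| ≤ ℓ → |φ - φ₀| ≤ ℓ → c ≤ |pairE₁ μ p θ φ|) ∨
      (∀ θ φ, |θ - θ₀| ≤ ℓ → |φ - φ₀| ≤ ℓ → c ≤ |pairE₂ μ p θ φ|) ∨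
      (∀ θ φ, |θ - θ₀| ≤ ℓ → |φ - φ₀| ≤ ℓ → c ≤ |pairE₁₁ μ p θ φ|) ∨
      (∀ θ φ, |θ - θ₀| ≤ ℓ → |φ - φ₀| ≤ ℓ → c ≤ |pairE₂₂ μ p θ φ|) ∨
      (∀ θ φ, |θ - θ₀| ≤ ℓ → |φ - φ₀| ≤ ℓ → c ≤ |pairEdd μ p θ φ|) := by
  rcases lt_or_ge μ₂ μ₁ with h21 | h12
  · refine ⟨1, 1, one_pos, one_pos, by linarith [Real.two_le_pi], fun μ hμ => absurd (hμ.1.trans hμ.2) (not_le.2 h21)⟩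
  -- the six functions on `𝕐`
  obtain ⟨hE0, hE1, hE2, hE11, hE22, hEdd⟩ := continuousOn_pairE_all
  set S : Set 𝕐 := {z : 𝕐 | z.1 ∈ Ioo (-4 : ℝ) 0} with hS
  set E0 : 𝕐 → ℝ := fun z => pairE z.1 z.2.1 z.2.2.1 z.2.2.2 with hE0d
  set E1 : 𝕐 → ℝ := fun z => pairE₁ z.1 z.2.1 z.2.2.1 z.2.2.2 with hE1d
  set E2 : 𝕐 → ℝ := fun z => pairE₂ z.1 z.2.1 z.2.2.1 z.2.2.2 with hE2d
  set E3 : 𝕐 → ℝ := fun z => pairE₁₁ z.1 z.2.1 z.2.2.1 z.2.2.2 with hE3d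
  set E4 : 𝕐 → ℝ := fun z => pairE₂₂ z.1 z.2.1 z.2.2.1 z.2.2.2 with hE4d
  set E5 : 𝕐 → ℝ := fun z => pairEdd z.1 z.2.1 z.2.2.1 z.2.2.2 with hE5d
  set F : 𝕐 → ℝ := fun z => max (max (max |E0 z| |E1 z|) (max |E2 z| |E3 z|)) (max |E4 z| |E5 z|) with hF
  have hFc : ContinuousOn F S := by
    have a0 : ContinuousOn (fun z => |E0 z|) S := continuous_abs.comp_continuousOn hE0
    have a1 : ContinuousOn (fun z => |E1 z|) S := continuous_abs.comp_continuousOn hE1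
    have a2 : ContinuousOn (fun z => |E2 z|) S := continuous_abs.comp_continuousOn hE2
    have a3 : ContinuousOn (fun z => |E3 z|) S := continuous_abs.comp_continuousOn hE11
    have a4 : ContinuousOn (fun z => |E4 z|) S := continuous_abs.comp_continuousOn hE22
    have a5 : ContinuousOn (fun z => |E5 z|) S := continuous_abs.comp_continuousOn hEdd
    have h := ((a0.sup a1).sup (a2.sup a3)).sup (a4.sup a5)
    exact h
  have hFpos : ∀ z ∈ S, 0 < F z := by
    intro z hz
    by_contra hle
    push Not at hle
    have h0 : |E0 z| ≤ 0 := le_trans (le_max_left _ _ |>.trans (le_max_left _ _) |>.trans (le_max_left _ _)) hle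
    have h1 : |E1 z| ≤ 0 := le_trans (le_max_right _ _ |>.trans (le_max_left _ _) |>.trans (le_max_left _ _)) hle
    have h2 : |E2 z| ≤ 0 := le_trans (le_max_left _ _ |>.trans (le_max_right _ _) |>.trans (le_max_left _ _)) hle
    have h3 : |E3 z| ≤ 0 := le_trans (le_max_right _ _ |>.trans (le_max_right _ _) |>.trans (le_max_left _ _)) hle
    have h4 : |E4 z| ≤ 0 := le_trans (le_max_left _ _ |>.trans (le_max_right _ _)) hle
    have h5 : |E5 z| ≤ 0 := le_trans (le_max_right _ _ |>.trans (le_max_right _ _)) hle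
    have e0 := abs_nonpos_iff.1 h0; have e1 := abs_nonpos_iff.1 h1; have e2 := abs_nonpos_iff.1 h2
    have e3 := abs_nonpos_iff.1 h3; have e4 := abs_nonpos_iff.1 h4; have e5 := abs_nonpos_iff.1 h5
    exact pairE_nondegenerate hz.1 hz.2 z.2.1 z.2.2.1 z.2.2.2 ⟨e0, e1, e2, e3, e4, e5⟩
  -- the compact period box (with margins in `θ, φ`)
  set K : Set 𝕐 := Icc μ₁ μ₂ ×ˢ ((Icc (-π) π ×ˢ Icc (-π) π) ×ˢ (Icc (-(2 * π)) (2 * π) ×ˢ Icc (-(2 * π)) (2 * π))) with hK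
  have hKc : IsCompact K := isCompact_Icc.prod ((isCompact_Icc.prod isCompact_Icc).prod (isCompact_Icc.prod isCompact_Icc))
  have hKS : K ⊆ S := fun z hz => ⟨h₁.trans_le hz.1.1, hz.1.2.trans_lt h₂⟩
  have hKne : K.Nonempty := ⟨(μ₁, (0, 0), 0, 0), ⟨left_mem_Icc.2 h12,
    ⟨⟨by constructor <;> linarith [Real.pi_pos], by constructor <;> linarith [Real.pi_pos]⟩,
     ⟨by constructor <;> linarith [Real.pi_pos], by constructor <;> linarith [Real.pi_pos]⟩⟩⟩⟩
  obtain ⟨z₀, hz₀, hmin⟩ := hKc.exists_isMinOn hKne (hFc.mono hKS)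
  set c₀ : ℝ := F z₀ with hc₀
  have hc₀pos : 0 < c₀ := hFpos z₀ (hKS hz₀)
  have hFge : ∀ z ∈ K, c₀ ≤ F z := fun z hz => hmin hz
  -- uniform continuity of the six functions on `K`
  have huc : ∀ {E : 𝕐 → ℝ}, ContinuousOn E S → ∃ δ > 0, ∀ z ∈ K, ∀ z' ∈ K, dist z z' < δ → dist (E z) (E z') < c₀ / 2 := by
    intro E hE
    have h := hKc.uniformContinuousOn_of_continuous (hE.mono hKS)
    rw [Metric.uniformContinuousOn_iff] at h
    exact h (c₀ / 2) (half_pos hc₀pos)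
  obtain ⟨δ0, hδ0, hu0⟩ := huc hE0
  obtain ⟨δ1, hδ1, hu1⟩ := huc hE1
  obtain ⟨δ2, hδ2, hu2⟩ := huc hE2
  obtain ⟨δ3, hδ3, hu3⟩ := huc hE11
  obtain ⟨δ4, hδ4, hu4⟩ := huc hE22
  obtain ⟨δ5, hδ5, hu5⟩ := huc hEdd
  set δ : ℝ := min (min (min δ0 δ1) (min δ2 δ3)) (min δ4 δ5) with hδ
  have hδpos : 0 < δ := by rw [hδ]; positivity
  have hδle : δ ≤ δ0 ∧ δ ≤ δ1 ∧ δ ≤ δ2 ∧ δ ≤ δ3 ∧ δ ≤ δ4 ∧ δ ≤ δ5 := by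
    rw [hδ]
    refine ⟨?_, ?_, ?_, ?_, ?_, ?_⟩
    · exact (min_le_left _ _).trans ((min_le_left _ _).trans (min_le_left _ _))
    · exact (min_le_left _ _).trans ((min_le_left _ _).trans (min_le_right _ _))
    · exact (min_le_left _ _).trans ((min_le_right _ _).trans (min_le_left _ _))
    · exact (min_le_left _ _).trans ((min_le_right _ _).trans (min_le_right _ _))
    · exact (min_le_right _ _).trans (min_le_left _ _)
    · exact (min_le_right _ _).trans (min_le_right _ _)
  set ℓ : ℝ := min π (δ / 2) with hℓ
  have hℓpos : 0 < ℓ := lt_min Real.pi_pos (half_pos hδpos)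
  have hℓπ : ℓ ≤ π := min_le_left _ _
  have hℓδ : ℓ < δ := (min_le_right _ _).trans_lt (half_lt_self hδpos)
  refine ⟨c₀ / 2, ℓ, half_pos hc₀pos, hℓpos, hℓπ, fun μ hμ p θ₀ hθ₀ φ₀ hφ₀ => ?_⟩
  -- reduce `p` and set up the two points of `K`
  obtain ⟨q, hq, hred⟩ := pairE_all_reduce μ p
  have hmemK : ∀ θ φ, |θ - θ₀| ≤ ℓ → |φ - φ₀| ≤ ℓ → ((μ, q, θ, φ) : 𝕐) ∈ K := by
    intro θ φ hθ hφ
    refine ⟨hμ, hq, ?_, ?_⟩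
    · have := abs_le.1 hθ
      exact ⟨by linarith [hθ₀.1], by linarith [hθ₀.2]⟩
    · have := abs_le.1 hφ
      exact ⟨by linarith [hφ₀.1], by linarith [hφ₀.2]⟩
  have hz₁ : ((μ, q, θ₀, φ₀) : 𝕐) ∈ K := hmemK θ₀ φ₀ (by simp [hℓpos.le]) (by simp [hℓpos.le])
  have hdist : ∀ θ φ, |θ - θ₀| ≤ ℓ → |φ - φ₀| ≤ ℓ → dist ((μ, q, θ, φ) : 𝕐) (μ, q, θ₀, φ₀) < δ := by
    intro θ φ hθ hφ
    rw [Prod.dist_eq, Prod.dist_eq]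
    refine max_lt (by rw [dist_self]; exact hδpos) (max_lt (by rw [dist_self]; exact hδpos) ?_)
    rw [Prod.dist_eq, Real.dist_eq, Real.dist_eq]
    exact max_lt (hθ.trans_lt hℓδ) (hφ.trans_lt hℓδ)
  -- transfer of a lower bound at the base point to the box
  have key : ∀ {E : 𝕐 → ℝ} {δE : ℝ},
      (∀ z ∈ K, ∀ z' ∈ K, dist z z' < δE → dist (E z) (E z') < c₀ / 2) → δ ≤ δE →
      c₀ ≤ |E (μ, q, θ₀, φ₀)| →
      ∀ θ φ, |θ - θ₀| ≤ ℓ → |φ - φ₀| ≤ ℓ → c₀ / 2 ≤ |E (μ, q, θ, φ)| := by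
    intro E δE hu hle hbase θ φ hθ hφ
    have hd := hu _ (hmemK θ φ hθ hφ) _ hz₁ ((hdist θ φ hθ hφ).trans_le hle)
    rw [Real.dist_eq] at hd
    have := abs_sub_abs_le_abs_sub (E (μ, q, θ₀, φ₀)) (E (μ, q, θ, φ))
    rw [abs_sub_comm] at hd
    linarith
  -- which of the six is large at the base point
  have hsel : c₀ ≤ |E0 (μ, q, θ₀, φ₀)| ∨ c₀ ≤ |E1 (μ, q, θ₀, φ₀)| ∨ c₀ ≤ |E2 (μ, q, θ₀, φ₀)| ∨
      c₀ ≤ |E3 (μ, q, θ₀, φ₀)| ∨ c₀ ≤ |E4 (μ, q, θ₀, φ₀)| ∨ c₀ ≤ |E5 (μ, q, θ₀, φ₀)| := by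
    by_contra hneg
    push Not at hneg
    obtain ⟨n0, n1, n2, n3, n4, n5⟩ := hneg
    have hlt : F (μ, q, θ₀, φ₀) < c₀ := max_lt (max_lt (max_lt n0 n1) (max_lt n2 n3)) (max_lt n4 n5)
    linarith [hFge _ hz₁]
  rcases hsel with h | h | h | h | h | h
  · refine Or.inl fun θ φ hθ hφ => ?_
    rw [← (hred θ φ).1]; exact key hu0 hδle.1 h θ φ hθ hφ
  · refine Or.inr (Or.inl fun θ φ hθ hφ => ?_)
    rw [← (hred θ φ).2.1]; exact key hu1 hδle.2.1 h θ φ hθ hφ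
  · refine Or.inr (Or.inr (Or.inl fun θ φ hθ hφ => ?_))
    rw [← (hred θ φ).2.2.1]; exact key hu2 hδle.2.2.1 h θ φ hθ hφ
  · refine Or.inr (Or.inr (Or.inr (Or.inl fun θ φ hθ hφ => ?_)))
    rw [← (hred θ φ).2.2.2.1]; exact key hu3 hδle.2.2.2.1 h θ φ hθ hφ
  · refine Or.inr (Or.inr (Or.inr (Or.inr (Or.inl fun θ φ hθ hφ => ?_))))
    rw [← (hred θ φ).2.2.2.2.1]; exact key hu4 hδle.2.2.2.2.1 h θ φ hθ hφ
  · refine Or.inr (Or.inr (Or.inr (Or.inr (Or.inr fun θ φ hθ hφ => ?_))))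
    rw [← (hred θ φ).2.2.2.2.2]; exact key hu5 hδle.2.2.2.2.2 h θ φ hθ hφ

end Literature.MathematicalPhysics.QuantumLattice

end
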